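import Summits.PneNP.PneNP.Theorems.ConstantBand.Negative.LoadBearing
import Summits.PneNP.PneNP.Theorems.SingleThreshold.Negative.Locality
import Summits.PneNP.PneNP.Theorems.SliceACZero.Negative.WindowDepth
import Summits.PneNP.PneNP.Theorems.OneSliceConstantBandTransferStepAux
import Literature.Computability.Complexity.RossmanMonotoneCliqueLemma23Proofs

/-!
# Crux `SliceTarget` (stmt-PneNP-2832), line `Sketch-ideator3-r1`: stub B2 `CliqueDensityLower`

On a central slice of the critical random graph (uniform edge vectors `x` with `edgeCount x = j`,
`|j - m_k(n)| ≤ m_k(n)^{3/4}`, `m_k(n) = thr k n = ⌊T⌋₊`, `T = C(n,2)·n^{-2/(k-1)}`) the graphs WITH a `k`-clique have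
density at least `λ - λ²/2 - ε` eventually, uniformly over the window, `λ = 1/k!` (`stub_cliqueDensityLower`).
Bonferroni (`cdl_bonferroni`, double counting): pointwise `2·𝟙[ω ≥ 1] ≥ 2ω - ω(ω-1)` for the number `ω = ω_k(x)` of
`k`-cliques, so `2·#{x ∈ slice_j : ω ≥ 1} ≥ 2·Σ_A #{x ∈ slice_j : K_A ⊆ x} - Σ_{A ≠ B} #{x ∈ slice_j : K_A ∪ K_B ⊆ x}`;
* first moment from below (`cdl_firstMoment_ge`): `#{x ∈ slice_j : K_A ⊆ x} = C(N-K, j-K)` (`N = C(n,2)`, `K = C(k,2)`),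
  `C(N,j)·(j+1-K)^K ≤ N^K·C(N-K, j-K)`, `(n+1-k)^k ≤ k!·C(n,k)` (descending factorials), `(n^{-2/(k-1)})^K = n^{-k}`,
  whence `Σ_A ≥ (1-k/n)^k a^K/k! · #slice_j` once `j ≥ T·a + K` (`a = 1 - T^{-1/4} - (K+1)/T → 1` on the window);
* second factorial moment from above (Rossman, FOCS 2010, App. B, proof of Lemma 23 (a), on the slice — the computation
  of stub T5 `CoincidenceTail2`; `cdl_pairSum_le`): `Σ_{A ≠ B} ≤ μ (μ + R(q)) · #slice_j`, `q = j/N`, `μ = C(n,k) q^K ≤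
  (1 + T^{-1/4})^K/k!`, `R(q) = Σ_{i=2}^{k-1} C(k,i) C(n,k-i) q^{K-C(i,2)} = O(Σ_i n^{-i(k-i)/(k-1)}) → 0`.
-/

set_option linter.dupNamespace false

namespace Summit.PneNP.PneNP.Cruxes.SliceTarget.Ideator3Line

open Literature.Computability.Complexity Finset Filter Classical
open scoped Topology
open Summit.PneNP.PneNP.Theorems.ConstantBand.Negative (Edge thr Central slice)
open Summit.PneNP.PneNP.Theorems.SingleThreshold.Negative (pc_pow_choose)
open Summit.PneNP.PneNP.Theorems.SliceACZero.Negative (choose_mul_ratio_pow_le')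
open Summit.PneNP.PneNP.Cruxes.ConstantBand.FlatPriorRelativeMinterms (ts_card_slice ts_card_slice_filter_supset
  ts_card_slice_filter_supset_mul_le ts_tendsto_T ts_T_mul_lower_le ts_le_T_mul_upper ts_tendsto_lower ts_tendsto_upper
  ts_central_iff)
open Literature.Computability.Complexity.Rossman2010L23 (card_inter_lt_of_ne)

noncomputable section

/-! ## Bonferroni on the slice -/

/-- Pointwise Bonferroni: `2w ≤ 2·𝟙[w ≠ 0] + (w² - w)` for `w ∈ ℕ`. [folklore] -/
private theorem cdl_two_mul_le : ∀ w : ℕ, 2 * w ≤ 2 * (if w = 0 then 0 else 1) + (w * w - w)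
  | 0 | 1 => by simp
  | m + 2 => by
    rw [if_neg (by omega), show (m + 2) * (m + 2) - (m + 2) = (m + 2) * (m + 1) by
      rw [show (m + 2) * (m + 2) = (m + 2) * (m + 1) + (m + 2) by ring, Nat.add_sub_cancel]]
    nlinarith

/-- **Bonferroni on the slice** (double counting): with `E_A = {x ∈ slice_j : K_A ⊆ x}`,
`2 Σ_A #E_A ≤ 2 #{x ∈ slice_j : ω_k(x) ≥ 1} + Σ_{A ≠ B} #(E_A ∩ E_B)` — pointwise `2ω ≤ 2·𝟙[ω ≥ 1] + ω(ω-1)` and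
`ω(ω-1) = #{(A,B) : A ≠ B, K_A ⊆ x, K_B ⊆ x}`. [folklore] -/
private theorem cdl_bonferroni (n k j : ℕ) :
    (2 : ℝ) * ∑ A ∈ powersetCard k (univ : Finset (Fin n)),
        (#((slice n j).filter fun x => ∀ e, cliqueVec A e = true → x e = true) : ℝ) ≤
      2 * (#((slice n j).filter fun x => cliqueFn n k x = true) : ℝ) +
        ∑ p ∈ (powersetCard k (univ : Finset (Fin n)) ×ˢ powersetCard k (univ : Finset (Fin n))).filter (fun p => p.1 ≠ p.2),
          (#((slice n j).filter fun x =>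
            (∀ e, cliqueVec p.1 e = true → x e = true) ∧ (∀ e, cliqueVec p.2 e = true → x e = true)) : ℝ) := by
  set 𝒜 := powersetCard k (univ : Finset (Fin n)) with h𝒜
  have hs1 := sum_card_bipartiteAbove_eq_sum_card_bipartiteBelow
    (fun (A : Finset (Fin n)) (x : Edge n → Bool) => ∀ e, cliqueVec A e = true → x e = true) (s := 𝒜) (t := slice n j)
  have hs2 := sum_card_bipartiteAbove_eq_sum_card_bipartiteBelow
    (fun (p : Finset (Fin n) × Finset (Fin n)) (x : Edge n → Bool) =>
      (∀ e, cliqueVec p.1 e = true → x e = true) ∧ (∀ e, cliqueVec p.2 e = true → x e = true))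
    (s := (𝒜 ×ˢ 𝒜).filter (fun p => p.1 ≠ p.2)) (t := slice n j)
  simp only [bipartiteAbove, bipartiteBelow] at hs1 hs2
  norm_cast
  rw [hs1, hs2, card_filter, mul_sum, mul_sum, ← sum_add_distrib]
  refine sum_le_sum fun x _ => ?_
  set T := 𝒜.filter fun A => ∀ e, cliqueVec A e = true → x e = true with hT
  have h2 : #T * #T - #T ≤ #(((𝒜 ×ˢ 𝒜).filter (fun p => p.1 ≠ p.2)).filter fun p =>
      (∀ e, cliqueVec p.1 e = true → x e = true) ∧ (∀ e, cliqueVec p.2 e = true → x e = true)) := by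
    rw [← offDiag_card]; refine card_le_card fun p hp => ?_
    simp only [hT, mem_offDiag, mem_filter, mem_product] at hp ⊢
    tauto
  have h3 : (if #T = 0 then 0 else 1) = (if cliqueFn n k x = true then 1 else 0) := by
    have h0 : #T = 0 ↔ cliqueFn n k x = false := by rw [← cliqueCount_eq_zero_iff]; rfl
    cases hc : cliqueFn n k x <;> simp [h0, hc]
  exact (h3 ▸ cdl_two_mul_le #T).trans (Nat.add_le_add_left h2 _)

/-! ## The first moment from below -/

/-- **First moment from below.** For `2 ≤ k ≤ n` and `a ≥ 0` with `N n^{-2/(k-1)} a + K ≤ j` (`N = C(n,2)`, `K = C(k,2)`):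
`(1 - k/n)^k · a^K / k! · #slice_j ≤ Σ_A #{x ∈ slice_j : K_A ⊆ x}`. The right side is `C(n,k) · C(N-K, j-K)` exactly;
`C(N,j) (N n^{-2/(k-1)} a)^K ≤ C(N,j) (j+1-K)^K ≤ N^K C(N-K, j-K)`, `(n^{-2/(k-1)})^K = n^{-k}`, `(n-k)^k ≤ k! C(n,k)`.
[folklore] -/
private theorem cdl_firstMoment_ge {n k j : ℕ} (hk : 2 ≤ k) (hkn : k ≤ n) {a : ℝ} (ha : 0 ≤ a)
    (hja : ((n.choose 2 : ℕ) : ℝ) * (n : ℝ) ^ (-(2 : ℝ) / ((k : ℝ) - 1)) * a + k.choose 2 ≤ j) :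
    (1 - (k : ℝ) / n) ^ k * a ^ k.choose 2 / k.factorial * #(slice n j) ≤
      ∑ A ∈ powersetCard k (univ : Finset (Fin n)),
        (#((slice n j).filter fun x => ∀ e, cliqueVec A e = true → x e = true) : ℝ) := by
  set N := n.choose 2 with hNdef
  set K := k.choose 2 with hKdef
  set θ : ℝ := (n : ℝ) ^ (-(2 : ℝ) / ((k : ℝ) - 1)) with hθ
  have hn0 : (0 : ℝ) < n := by exact_mod_cast (show 0 < n by omega)
  have hθ0 : 0 ≤ θ := Real.rpow_nonneg hn0.le _
  have hNr : (0 : ℝ) < N := by exact_mod_cast Nat.choose_pos (show 2 ≤ n by omega)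
  have hNθa : 0 ≤ (N : ℝ) * θ * a := by positivity
  have hKj : K ≤ j := by exact_mod_cast (show ((K : ℕ) : ℝ) ≤ j by linarith)
  -- the exact count `#E_A = C(N-K, j-K)` (on-set bijection)
  have hcount : ∀ A ∈ powersetCard k (univ : Finset (Fin n)),
      #((slice n j).filter fun x => ∀ e, cliqueVec A e = true → x e = true) = (N - K).choose (j - K) := by
    intro A hA
    have hF : #(univ.filter fun e : Edge n => cliqueVec A e = true) = K := by
      rw [card_filter_cliqueVec, (mem_powersetCard.1 hA).2]
    rw [← hF, ← ts_card_slice_filter_supset _ (hF.symm ▸ hKj)]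
    exact congrArg card (filter_congr fun x _ => by simp only [mem_filter, mem_univ, true_and])
  rw [sum_congr rfl fun A hA => by rw [hcount A hA], sum_const, card_powersetCard, card_univ, Fintype.card_fin,
    nsmul_eq_mul, ts_card_slice]
  -- `C(N,j)·(N θ a)^K ≤ C(N,j)·(j+1-K)^K ≤ N^K·C(N-K,j-K)` and `(n-k)^k ≤ (n+1-k)^k ≤ k!·C(n,k)` (descending factorials)
  have h1 : ((N.choose j : ℕ) : ℝ) * (θ * a) ^ K ≤ ((N - K).choose (j - K) : ℕ) := by
    have hnat : N.choose j * (j + 1 - K) ^ K ≤ N ^ K * (N - K).choose (j - K) :=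
      calc N.choose j * (j + 1 - K) ^ K ≤ N.choose j * j.descFactorial K :=
            Nat.mul_le_mul_left _ (Nat.pow_sub_le_descFactorial j K)
        _ = N.descFactorial K * (N - K).choose (j - K) := by
            rw [Nat.descFactorial_eq_factorial_mul_choose, Nat.descFactorial_eq_factorial_mul_choose, mul_left_comm,
              Nat.choose_mul hKj, mul_assoc]
        _ ≤ N ^ K * (N - K).choose (j - K) := Nat.mul_le_mul_right _ (Nat.descFactorial_le_pow N K)
    have hlow : (N : ℝ) * θ * a ≤ ((j + 1 - K : ℕ) : ℝ) := by
      rw [Nat.cast_sub (by omega : K ≤ j + 1)]; push_cast; linarith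
    refine le_of_mul_le_mul_right ?_ (pow_pos hNr K)
    calc ((N.choose j : ℕ) : ℝ) * (θ * a) ^ K * (N : ℝ) ^ K = (N.choose j : ℕ) * ((N : ℝ) * θ * a) ^ K := by ring
      _ ≤ (N.choose j : ℕ) * ((j + 1 - K : ℕ) : ℝ) ^ K := by gcongr
      _ ≤ (N : ℝ) ^ K * ((N - K).choose (j - K) : ℕ) := by exact_mod_cast hnat
      _ = ((N - K).choose (j - K) : ℕ) * (N : ℝ) ^ K := mul_comm _ _
  have h2 : ((n : ℝ) - k) ^ k ≤ k.factorial * (n.choose k : ℝ) := by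
    have h : (n + 1 - k) ^ k ≤ k.factorial * n.choose k :=
      (Nat.pow_sub_le_descFactorial n k).trans_eq (Nat.descFactorial_eq_factorial_mul_choose n k)
    have hk' : (k : ℝ) ≤ n := by exact_mod_cast hkn
    refine (pow_le_pow_left₀ (by linarith) ?_ k).trans (show ((n + 1 - k : ℕ) : ℝ) ^ k ≤ _ by exact_mod_cast h)
    rw [Nat.cast_sub (by omega)]; push_cast; linarith
  have hθK : θ ^ K = ((n : ℝ) ^ k)⁻¹ := pc_pow_choose (by omega) hk
  calc (1 - (k : ℝ) / n) ^ k * a ^ K / k.factorial * ((N.choose j : ℕ) : ℝ)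
      = ((n : ℝ) - k) ^ k / k.factorial * (((N.choose j : ℕ) : ℝ) * (θ * a) ^ K) := by
        rw [mul_pow, hθK, show (1 : ℝ) - k / n = ((n : ℝ) - k) / n by field_simp, div_pow]
        field_simp
    _ ≤ (k.factorial * (n.choose k : ℝ)) / k.factorial * ((N - K).choose (j - K) : ℕ) := by gcongr
    _ = (n.choose k : ℝ) * ((N - K).choose (j - K) : ℕ) := by field_simp

/-! ## The second factorial moment from above -/

/-- **Two cliques on a slice**: for `k`-sets `A, B` and `j ≤ C(n,2)`, with `q = j/C(n,2)`,
`#{x ∈ slice_j : K_A ⊆ x ∧ K_B ⊆ x} ≤ q^{C(k,2)} · q^{C(k,2) - C(|A ∩ B|,2)} · #slice_j` — the hypergeometric tail for the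
edge set `F = E(K_A) ∪ E(K_B)`, `|F| + C(|A ∩ B|,2) = 2 C(k,2)` as `E(K_A) ∩ E(K_B) = E(K_{A ∩ B})`. [folklore] -/
private theorem cdl_card_slice_twoCliques_le {n k j : ℕ} (hjN : j ≤ n.choose 2) (hN : 0 < n.choose 2)
    {A B : Finset (Fin n)} (hA : #A = k) (hB : #B = k) :
    (#((slice n j).filter fun x => (∀ e, cliqueVec A e = true → x e = true) ∧ (∀ e, cliqueVec B e = true → x e = true)) : ℝ)
      ≤ ((j : ℝ) / (n.choose 2 : ℕ)) ^ k.choose 2 * ((j : ℝ) / (n.choose 2 : ℕ)) ^ (k.choose 2 - (#(A ∩ B)).choose 2) *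
        #(slice n j) := by
  -- adapted from Theorems/OneSliceSliceTargetCoincidenceTail2.lean (`card_cliqueEdges_union_add`, `card_slice_twoCliques_le`)
  set F : Finset (Edge n) := univ.filter fun e : Edge n => cliqueVec A e = true ∨ cliqueVec B e = true with hF
  have hCle : (#(A ∩ B)).choose 2 ≤ k.choose 2 := Nat.choose_le_choose 2 (hA ▸ card_le_card inter_subset_left)
  have hcardF : #F = k.choose 2 + (k.choose 2 - (#(A ∩ B)).choose 2) := by
    have hinter : (univ.filter fun e : Edge n => cliqueVec A e = true) ∩ (univ.filter fun e : Edge n => cliqueVec B e = true) =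
        univ.filter fun e : Edge n => cliqueVec (A ∩ B) e = true := by
      rw [← filter_and]
      exact filter_congr fun e _ => by rw [cliqueVec_inter, Bool.and_eq_true]; tauto
    have h := card_union_add_card_inter (univ.filter fun e : Edge n => cliqueVec A e = true)
      (univ.filter fun e : Edge n => cliqueVec B e = true)
    rw [hinter, ← filter_or, ← hF, card_filter_cliqueVec, card_filter_cliqueVec, card_filter_cliqueVec, hA, hB] at h
    omega
  have h1 := ts_card_slice_filter_supset_mul_le F hjN
  have h2 : #((slice n j).filter fun x => (∀ e, cliqueVec A e = true → x e = true) ∧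
      (∀ e, cliqueVec B e = true → x e = true)) ≤ #((slice n j).filter fun x => ∀ e ∈ F, x e = true) := by
    refine card_le_card fun x hx => ?_
    simp only [mem_filter, hF, mem_univ, true_and] at hx ⊢
    exact ⟨hx.1, fun e he => he.elim (hx.2.1 e) (hx.2.2 e)⟩
  have hNr : (0 : ℝ) < (n.choose 2 : ℕ) := by exact_mod_cast hN
  rw [← pow_add, ← hcardF, div_pow, div_mul_eq_mul_div, le_div_iff₀ (pow_pos hNr _)]
  calc (#((slice n j).filter fun x => (∀ e, cliqueVec A e = true → x e = true) ∧
          (∀ e, cliqueVec B e = true → x e = true)) : ℝ) * ((n.choose 2 : ℕ) : ℝ) ^ #F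
      ≤ (#((slice n j).filter fun x => ∀ e ∈ F, x e = true) : ℝ) * ((n.choose 2 : ℕ) : ℝ) ^ #F := by gcongr
    _ ≤ (j : ℝ) ^ #F * #(slice n j) := by exact_mod_cast h1

/-- The `k`-sets meeting a fixed `k`-set `A` in exactly `i` vertices number at most `C(k,i) · C(n,k-i)`
(`B ↦ (A ∩ B, B ∖ A)` is injective). [folklore] -/
private theorem cdl_card_filter_card_inter_eq_le {n k : ℕ} {A : Finset (Fin n)} (hA : #A = k) (i : ℕ) :
    #((powersetCard k (univ : Finset (Fin n))).filter fun B => #(A ∩ B) = i) ≤ k.choose i * n.choose (k - i) := by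
  -- adapted from the fibre count in `Rossman2010L23.gnpProb_bad_le` (RossmanMonotoneCliqueLemma23Proofs.lean)
  calc #((powersetCard k (univ : Finset (Fin n))).filter fun B => #(A ∩ B) = i)
      ≤ #((powersetCard i A) ×ˢ (powersetCard (k - i) (univ : Finset (Fin n)))) := by
        refine card_le_card_of_injOn (fun B => (A ∩ B, B \ A)) (fun B hB => ?_) (fun B₁ _ B₂ _ h => ?_)
        · obtain ⟨hB𝒜, hi⟩ := mem_filter.1 (mem_coe.1 hB)
          have hBk : #B = k := (mem_powersetCard.1 hB𝒜).2
          simp only [mem_coe, mem_product, mem_powersetCard]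
          refine ⟨⟨inter_subset_left, hi⟩, subset_univ _, ?_⟩
          have := card_sdiff_add_card_inter B A
          rw [inter_comm] at hi
          omega
        · simp only [Prod.mk.injEq] at h
          rw [← sdiff_union_inter B₁ A, ← sdiff_union_inter B₂ A, inter_comm B₁ A, inter_comm B₂ A, h.1, h.2]
    _ = k.choose i * n.choose (k - i) := by
        rw [card_product, card_powersetCard, card_powersetCard, hA, card_univ, Fintype.card_fin]

/-- **The overlap sum, split by `i = |A ∩ B|`**: for a `k`-set `A` and `q ≥ 0`,
`Σ_{B ≠ A} q^{C(k,2)} q^{C(k,2) - C(|A ∩ B|,2)} ≤ q^{C(k,2)} (C(n,k) q^{C(k,2)} + Σ_{i=2}^{k-1} C(k,i) C(n,k-i) q^{C(k,2) - C(i,2)})`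
— the `B` with `|A ∩ B| ≤ 1` are edge-disjoint from `A`, the others have `2 ≤ |A ∩ B| ≤ k - 1`. [folklore] -/
private theorem cdl_sum_ite_pow_le {n k : ℕ} {A : Finset (Fin n)} (hA : A ∈ powersetCard k (univ : Finset (Fin n))) {q : ℝ}
    (hq : 0 ≤ q) :
    ∑ B ∈ powersetCard k (univ : Finset (Fin n)), (if A ≠ B then q ^ k.choose 2 * q ^ (k.choose 2 - (#(A ∩ B)).choose 2) else 0)
      ≤ q ^ k.choose 2 * ((n.choose k : ℝ) * q ^ k.choose 2 +
        ∑ i ∈ Ico 2 k, ((k.choose i * n.choose (k - i) : ℕ) : ℝ) * q ^ (k.choose 2 - i.choose 2)) := by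
  -- adapted from Theorems/OneSliceSliceTargetCoincidenceTail2.lean (`sum_ite_pow_le`)
  set 𝒜 := powersetCard k (univ : Finset (Fin n)) with h𝒜
  have hAk : #A = k := (mem_powersetCard.1 hA).2
  rw [← sum_filter, ← mul_sum]
  refine mul_le_mul_of_nonneg_left ?_ (pow_nonneg hq _)
  rw [← sum_filter_add_sum_filter_not (𝒜.filter fun B => A ≠ B) (fun B => #(A ∩ B) ≤ 1)]
  refine add_le_add ?_ ?_
  · calc ∑ B ∈ (𝒜.filter fun B => A ≠ B).filter (fun B => #(A ∩ B) ≤ 1), q ^ (k.choose 2 - (#(A ∩ B)).choose 2)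
        = ∑ B ∈ (𝒜.filter fun B => A ≠ B).filter (fun B => #(A ∩ B) ≤ 1), q ^ k.choose 2 := by
          refine sum_congr rfl fun B hB => ?_
          rw [Nat.choose_eq_zero_of_lt (show #(A ∩ B) < 2 by have := (mem_filter.1 hB).2; omega), Nat.sub_zero]
      _ ≤ (#𝒜 : ℝ) * q ^ k.choose 2 := by
          rw [sum_const, nsmul_eq_mul]
          gcongr
          exact (filter_subset _ _).trans (filter_subset _ _)
      _ = (n.choose k : ℝ) * q ^ k.choose 2 := by rw [h𝒜, card_powersetCard, card_univ, Fintype.card_fin]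
  · have hmaps : ∀ B ∈ 𝒜.filter (fun B => #(A ∩ B) ∈ Ico 2 k), (fun B => #(A ∩ B)) B ∈ Ico 2 k :=
      fun B hB => (mem_filter.1 hB).2
    calc ∑ B ∈ (𝒜.filter fun B => A ≠ B).filter (fun B => ¬ #(A ∩ B) ≤ 1), q ^ (k.choose 2 - (#(A ∩ B)).choose 2)
        ≤ ∑ B ∈ 𝒜.filter (fun B => #(A ∩ B) ∈ Ico 2 k), q ^ (k.choose 2 - (#(A ∩ B)).choose 2) := by
          refine sum_le_sum_of_subset_of_nonneg (fun B hB => ?_) (fun _ _ _ => pow_nonneg hq _)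
          simp only [mem_filter, mem_Ico] at hB ⊢
          exact ⟨hB.1.1, by omega, card_inter_lt_of_ne hA hB.1.1 hB.1.2.symm⟩
      _ = ∑ i ∈ Ico 2 k, ∑ B ∈ (𝒜.filter (fun B => #(A ∩ B) ∈ Ico 2 k)).filter (fun B => #(A ∩ B) = i),
            q ^ (k.choose 2 - i.choose 2) := (sum_fiberwise_of_maps_to' hmaps (fun i => q ^ (k.choose 2 - i.choose 2))).symm
      _ ≤ ∑ i ∈ Ico 2 k, ((k.choose i * n.choose (k - i) : ℕ) : ℝ) * q ^ (k.choose 2 - i.choose 2) := by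
          refine sum_le_sum fun i _ => ?_
          rw [sum_const, nsmul_eq_mul, filter_filter]
          refine mul_le_mul_of_nonneg_right ?_ (pow_nonneg hq _)
          exact_mod_cast (card_le_card (fun B hB => by simp only [mem_filter] at hB ⊢; exact ⟨hB.1, hB.2.2⟩)).trans
            (cdl_card_filter_card_inter_eq_le hAk i)

/-- **Second factorial moment on the slice**: for `j ≤ N = C(n,2)`, `q = j/N` and `μ = C(n,k) q^{C(k,2)}`,
`Σ_{A ≠ B} #{x ∈ slice_j : K_A ⊆ x ∧ K_B ⊆ x} ≤ μ · (μ + Σ_{i=2}^{k-1} C(k,i) C(n,k-i) q^{C(k,2)-C(i,2)}) · #slice_j`.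
[folklore] -/
private theorem cdl_pairSum_le {n k j : ℕ} (hjN : j ≤ n.choose 2) (hN : 0 < n.choose 2) :
    ∑ p ∈ (powersetCard k (univ : Finset (Fin n)) ×ˢ powersetCard k (univ : Finset (Fin n))).filter (fun p => p.1 ≠ p.2),
        (#((slice n j).filter fun x =>
          (∀ e, cliqueVec p.1 e = true → x e = true) ∧ (∀ e, cliqueVec p.2 e = true → x e = true)) : ℝ) ≤
      (n.choose k : ℝ) * ((j : ℝ) / (n.choose 2 : ℕ)) ^ k.choose 2 *
        ((n.choose k : ℝ) * ((j : ℝ) / (n.choose 2 : ℕ)) ^ k.choose 2 +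
          ∑ i ∈ Ico 2 k, ((k.choose i * n.choose (k - i) : ℕ) : ℝ) * ((j : ℝ) / (n.choose 2 : ℕ)) ^ (k.choose 2 - i.choose 2)) *
        #(slice n j) := by
  -- adapted from Theorems/OneSliceSliceTargetCoincidenceTail2.lean (`two_mul_card_le_moment`)
  set 𝒜 := powersetCard k (univ : Finset (Fin n)) with h𝒜
  set q : ℝ := (j : ℝ) / (n.choose 2 : ℕ) with hq
  have hq0 : 0 ≤ q := div_nonneg (Nat.cast_nonneg _) (Nat.cast_nonneg _)
  have h3 : ∑ p ∈ (𝒜 ×ˢ 𝒜).filter (fun p => p.1 ≠ p.2), q ^ k.choose 2 * q ^ (k.choose 2 - (#(p.1 ∩ p.2)).choose 2) ≤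
      (n.choose k : ℝ) * q ^ k.choose 2 * ((n.choose k : ℝ) * q ^ k.choose 2 +
        ∑ i ∈ Ico 2 k, ((k.choose i * n.choose (k - i) : ℕ) : ℝ) * q ^ (k.choose 2 - i.choose 2)) := by
    rw [sum_filter, sum_product]
    calc ∑ A ∈ 𝒜, ∑ B ∈ 𝒜, (if (A, B).1 ≠ (A, B).2 then q ^ k.choose 2 * q ^ (k.choose 2 - (#((A, B).1 ∩ (A, B).2)).choose 2) else 0)
        ≤ ∑ A ∈ 𝒜, q ^ k.choose 2 * ((n.choose k : ℝ) * q ^ k.choose 2 +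
            ∑ i ∈ Ico 2 k, ((k.choose i * n.choose (k - i) : ℕ) : ℝ) * q ^ (k.choose 2 - i.choose 2)) :=
          sum_le_sum fun A hA => cdl_sum_ite_pow_le hA hq0
      _ = _ := by rw [sum_const, nsmul_eq_mul, h𝒜, card_powersetCard, card_univ, Fintype.card_fin]; ring
  calc ∑ p ∈ (𝒜 ×ˢ 𝒜).filter (fun p => p.1 ≠ p.2), (#((slice n j).filter fun x =>
          (∀ e, cliqueVec p.1 e = true → x e = true) ∧ (∀ e, cliqueVec p.2 e = true → x e = true)) : ℝ)
      ≤ ∑ p ∈ (𝒜 ×ˢ 𝒜).filter (fun p => p.1 ≠ p.2), q ^ k.choose 2 * q ^ (k.choose 2 - (#(p.1 ∩ p.2)).choose 2) * #(slice n j) := by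
        refine sum_le_sum fun p hp => ?_
        simp only [mem_filter, mem_product] at hp
        exact cdl_card_slice_twoCliques_le hjN hN (mem_powersetCard.1 hp.1.1).2 (mem_powersetCard.1 hp.1.2).2
    _ ≤ _ := by rw [← sum_mul]; exact mul_le_mul_of_nonneg_right h3 (Nat.cast_nonneg _)

/-! ## Assembly -/

/-- **B2 `CliqueDensityLower`** (the clique density of a central slice from below; Bonferroni with the first two
factorial moments of `ω_k` on the slice, cf. Rossman, FOCS 2010, App. B): for `k ≥ 3` and `ε > 0`, eventually in `n`,
on every central slice `#{x ∈ slice_j : ω_k(x) ≥ 1} ≥ (1/k! - (1/k!)²/2 - ε) · #slice_j`. [folklore] -/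
theorem stub_cliqueDensityLower :
    ∀ k : ℕ, 3 ≤ k → ∀ ε : ℝ, 0 < ε → ∀ᶠ n : ℕ in atTop, ∀ j : ℕ, Central k n j →
      (1 / (k.factorial : ℝ) - (1 / (k.factorial : ℝ)) ^ 2 / 2 - ε) * #(slice n j) ≤
        #((slice n j).filter fun x => cliqueFn n k x = true) := by
  intro k hk ε hε
  obtain ⟨hk2, hk1r⟩ : 2 ≤ k ∧ (1 : ℝ) < k := ⟨by omega, by exact_mod_cast (show 1 < k by omega)⟩
  -- threshold density `p`, scale `T = C(n,2) p`, window factors `up` (upper) and `a` (lower), overlap error `R`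
  obtain ⟨p, hp⟩ : ∃ p : ℕ → ℝ, ∀ n : ℕ, p n = (n : ℝ) ^ (-(2 : ℝ) / ((k : ℝ) - 1)) := ⟨_, fun _ => rfl⟩
  obtain ⟨T, hT⟩ : ∃ T : ℕ → ℝ, ∀ n : ℕ, T n = ((n.choose 2 : ℕ) : ℝ) * p n := ⟨_, fun _ => rfl⟩
  obtain ⟨up, hup⟩ : ∃ up : ℕ → ℝ, ∀ n : ℕ, up n = 1 + (T n) ^ (-(1 / 4 : ℝ)) + ((0 : ℕ) : ℝ) / T n :=
    ⟨_, fun _ => rfl⟩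
  obtain ⟨a, ha⟩ : ∃ a : ℕ → ℝ, ∀ n : ℕ, a n = 1 - (T n) ^ (-(1 / 4 : ℝ)) - 1 / T n - (k.choose 2 : ℝ) / T n :=
    ⟨_, fun _ => rfl⟩
  obtain ⟨R, hR⟩ : ∃ R : ℕ → ℝ, ∀ n : ℕ, R n =
      ∑ i ∈ Ico 2 k, ((k.choose i * n.choose (k - i) : ℕ) : ℝ) * (2 * p n) ^ (k.choose 2 - i.choose 2) := ⟨_, fun _ => rfl⟩
  have hp0 : ∀ n : ℕ, 0 ≤ p n := fun n => by rw [hp n]; exact Real.rpow_nonneg (Nat.cast_nonneg _) _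
  have hplim : Tendsto p atTop (𝓝 0) := (tendsto_rpow_threshold hk2).congr fun n => (hp n).symm
  have hTlim : Tendsto T atTop atTop := (ts_tendsto_T hk).congr fun n => by rw [hT n, hp n]
  have huplim : Tendsto up atTop (𝓝 1) := (ts_tendsto_upper hTlim 0).congr fun n => (hup n).symm
  have halim : Tendsto a atTop (𝓝 1) := by
    have h := (ts_tendsto_lower hTlim).sub ((tendsto_const_nhds (x := (k.choose 2 : ℝ))).div_atTop hTlim)
    exact (sub_zero (1 : ℝ) ▸ h).congr fun n => (ha n).symm
  have hblim : Tendsto (fun n : ℕ => 1 - (k : ℝ) / n) atTop (𝓝 1) := by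
    have h := (tendsto_const_nhds (x := (1 : ℝ))).sub ((tendsto_const_nhds (x := (k : ℝ))).div_atTop tendsto_natCast_atTop_atTop)
    rwa [sub_zero] at h
  -- `R → 0`: the term `i` is `O(n^{k-i} · n^{-(2/(k-1))(C(k,2)-C(i,2))}) = O(n^{-i(k-i)/(k-1)})`
  -- (adapted from `Rossman2010_plantedVsConditioned_holds`, RossmanMonotoneCliqueLemma23Proofs.lean)
  have hRlim : Tendsto R atTop (𝓝 0) := by
    have hterm : ∀ i ∈ Ico 2 k, Tendsto (fun n : ℕ =>
        ((k.choose i * n.choose (k - i) : ℕ) : ℝ) * (2 * p n) ^ (k.choose 2 - i.choose 2)) atTop (𝓝 0) := by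
      intro i hi
      rw [mem_Ico] at hi
      have hiK : i.choose 2 ≤ k.choose 2 := Nat.choose_le_choose 2 hi.2.le
      have hexp : ((k - i : ℕ) : ℝ) + -(2 : ℝ) / ((k : ℝ) - 1) * ((k.choose 2 - i.choose 2 : ℕ) : ℝ) =
          -((i : ℝ) * ((k : ℝ) - i) / ((k : ℝ) - 1)) := by
        have hk1' : (k : ℝ) - 1 ≠ 0 := by linarith
        rw [Nat.cast_sub hiK, Nat.cast_choose_two, Nat.cast_choose_two, Nat.cast_sub hi.2.le]
        field_simp; ring
      have hi2 : (2 : ℝ) ≤ i := by exact_mod_cast hi.1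
      have hik : (i : ℝ) < k := by exact_mod_cast hi.2
      have hneg : 0 < (i : ℝ) * ((k : ℝ) - i) / ((k : ℝ) - 1) := div_pos (mul_pos (by linarith) (by linarith)) (by linarith)
      have hlim' := ((tendsto_rpow_neg_atTop hneg).comp tendsto_natCast_atTop_atTop).const_mul
        ((k.choose i : ℝ) * 2 ^ (k.choose 2 - i.choose 2))
      rw [mul_zero] at hlim'
      refine squeeze_zero' (Eventually.of_forall fun n =>
        mul_nonneg (Nat.cast_nonneg _) (pow_nonneg (mul_nonneg zero_le_two (hp0 n)) _)) ?_ hlim'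
      filter_upwards [eventually_ge_atTop 1] with n hn1
      have hn0 : (0 : ℝ) < n := by exact_mod_cast hn1
      have h1 : ((k.choose i * n.choose (k - i) : ℕ) : ℝ) ≤ (k.choose i : ℝ) * (n : ℝ) ^ ((k - i : ℕ) : ℝ) := by
        rw [Real.rpow_natCast]; push_cast
        exact mul_le_mul_of_nonneg_left (by exact_mod_cast Nat.choose_le_pow n (k - i)) (Nat.cast_nonneg _)
      calc ((k.choose i * n.choose (k - i) : ℕ) : ℝ) * (2 * p n) ^ (k.choose 2 - i.choose 2)
          ≤ (k.choose i : ℝ) * (n : ℝ) ^ ((k - i : ℕ) : ℝ) *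
              (2 ^ (k.choose 2 - i.choose 2) * ((n : ℝ) ^ (-(2 : ℝ) / ((k : ℝ) - 1))) ^ (k.choose 2 - i.choose 2)) := by
            rw [mul_pow, hp n]
            exact mul_le_mul_of_nonneg_right h1 (by positivity)
        _ = (k.choose i : ℝ) * 2 ^ (k.choose 2 - i.choose 2) * (n : ℝ) ^ (-((i : ℝ) * ((k : ℝ) - i) / ((k : ℝ) - 1))) := by
            rw [← Real.rpow_mul_natCast hn0.le, ← hexp, Real.rpow_add hn0]
            ring
    have hsum := tendsto_finsetSum (Ico 2 k) hterm
    rw [sum_const_zero] at hsum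
    exact hsum.congr fun n => (hR n).symm
  -- the minorant `2·(1-k/n)^k a^K/k! - (up^K/k!)·(up^K/k! + R)` tends to `2λ - λ²`
  have hGlim : Tendsto (fun n : ℕ => 2 * ((1 - (k : ℝ) / n) ^ k * a n ^ k.choose 2 / (k.factorial : ℝ)) -
      up n ^ k.choose 2 / (k.factorial : ℝ) * (up n ^ k.choose 2 / (k.factorial : ℝ) + R n)) atTop
      (𝓝 (2 * (1 / (k.factorial : ℝ)) - (1 / (k.factorial : ℝ)) ^ 2)) := by
    have h1 := ((hblim.pow k).mul (halim.pow (k.choose 2))).div_const (k.factorial : ℝ)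
    have h2 := (huplim.pow (k.choose 2)).div_const (k.factorial : ℝ)
    have h := (h1.const_mul 2).sub (h2.mul (h2.add hRlim))
    simpa only [one_pow, one_mul, add_zero, ← pow_two] using h
  have eG := (tendsto_order.1 hGlim).1 _
    (show 2 * (1 / (k.factorial : ℝ)) - (1 / (k.factorial : ℝ)) ^ 2 - 2 * ε < _ by linarith)
  have eup : ∀ᶠ n : ℕ in atTop, up n < 2 := (tendsto_order.1 huplim).2 _ (by norm_num)
  have ep : ∀ᶠ n : ℕ in atTop, p n < 1 / 2 := (tendsto_order.1 hplim).2 _ (by norm_num)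
  have ea : ∀ᶠ n : ℕ in atTop, 0 < a n := (tendsto_order.1 halim).1 _ one_pos
  filter_upwards [eG, eup, ep, ea, hTlim.eventually_ge_atTop 1, eventually_ge_atTop k] with n hGn hupn hpn han hTn hkn j hj
  have hn1 : 1 ≤ n := by omega
  have hN : 0 < n.choose 2 := Nat.choose_pos (by omega)
  have hNr : (0 : ℝ) < (n.choose 2 : ℕ) := by exact_mod_cast hN
  have hT0 : 0 < T n := by linarith
  have hup0 : 0 ≤ up n := by
    rw [hup n, Nat.cast_zero, zero_div, add_zero]; exact add_nonneg zero_le_one (Real.rpow_nonneg hT0.le _)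
  -- the window: `T a + K ≤ j ≤ T up ≤ C(n,2)`
  have hj' : |(j : ℝ) - (⌊T n⌋₊ : ℝ)| ≤ (⌊T n⌋₊ : ℝ) ^ ((3 : ℝ) / 4) := by
    have h := ts_central_iff.1 hj; rwa [← hp n, ← hT n] at h
  have hjup : (j : ℝ) ≤ T n * up n := by rw [hup n]; exact ts_le_T_mul_upper hT0 hj' (Nat.le_add_right j 0)
  have hja : ((n.choose 2 : ℕ) : ℝ) * (n : ℝ) ^ (-(2 : ℝ) / ((k : ℝ) - 1)) * a n + k.choose 2 ≤ j := by
    have h := ts_T_mul_lower_le hT0 hj'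
    have h2 : T n * a n + k.choose 2 = T n * (1 - T n ^ (-(1 / 4 : ℝ)) - 1 / T n) := by
      rw [ha n]; field_simp; ring
    rw [← hp n, ← hT n]
    linarith
  have hjN : j ≤ n.choose 2 := by
    have h : p n * up n ≤ 1 := by nlinarith [hp0 n]
    have : (j : ℝ) ≤ (n.choose 2 : ℕ) := hjup.trans (by rw [hT n, mul_assoc]; exact mul_le_of_le_one_right hNr.le h)
    exact_mod_cast this
  set q : ℝ := (j : ℝ) / (n.choose 2 : ℕ) with hqdef
  have hq0 : 0 ≤ q := div_nonneg (Nat.cast_nonneg _) hNr.le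
  have hqp : q ≤ 2 * p n := by
    rw [hqdef, div_le_iff₀ hNr]
    exact hjup.trans (by rw [hT n]; nlinarith [mul_nonneg hNr.le (hp0 n)])
  -- `μ = C(n,k) q^{C(k,2)} ≤ up^{C(k,2)}/k!` and `R(q) ≤ R n`, so `Σ_{A ≠ B} ≤ (up^K/k!)(up^K/k! + R) · #slice_j`
  have hμ : (n.choose k : ℝ) * q ^ k.choose 2 ≤ up n ^ k.choose 2 / (k.factorial : ℝ) :=
    choose_mul_ratio_pow_le' hk2 hn1 hN (by rw [← hp n, ← hT n]; exact hjup)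
  have hRq : ∑ i ∈ Ico 2 k, ((k.choose i * n.choose (k - i) : ℕ) : ℝ) * q ^ (k.choose 2 - i.choose 2) ≤ R n := by
    rw [hR n]
    exact sum_le_sum fun i _ => mul_le_mul_of_nonneg_left (pow_le_pow_left₀ hq0 hqp _) (Nat.cast_nonneg _)
  have hμ0 : 0 ≤ (n.choose k : ℝ) * q ^ k.choose 2 := by positivity
  have hR0 : 0 ≤ ∑ i ∈ Ico 2 k, ((k.choose i * n.choose (k - i) : ℕ) : ℝ) * q ^ (k.choose 2 - i.choose 2) :=
    sum_nonneg fun i _ => mul_nonneg (Nat.cast_nonneg _) (pow_nonneg hq0 _)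
  have hm0 : 0 ≤ up n ^ k.choose 2 / (k.factorial : ℝ) := div_nonneg (pow_nonneg hup0 _) (Nat.cast_nonneg _)
  have hpair := (cdl_pairSum_le (k := k) hjN hN).trans (mul_le_mul_of_nonneg_right
    (mul_le_mul hμ (add_le_add hμ hRq) (add_nonneg hμ0 hR0) hm0) (Nat.cast_nonneg (#(slice n j))))
  -- the first moment from below, Bonferroni, and the combination
  have hfirst := cdl_firstMoment_ge hk2 hkn han.le hja
  have hbon := cdl_bonferroni n k j
  have key := mul_le_mul_of_nonneg_right hGn.le (Nat.cast_nonneg (#(slice n j)))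
  linarith

end

end Summit.PneNP.PneNP.Cruxes.SliceTarget.Ideator3Line
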